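import Mathlib
import Literature.Barriers.ValiantsHypothesis.AlgebraicNaturalProofs
import Summits.ValiantsHypothesis.ValiantsHypothesis.Theorems.BarrierLeverDefinableEquationsSparsityWallTwoEngine
import Summits.ValiantsHypothesis.ValiantsHypothesis.Theorems.BarrierLeverSuccinctHittingSetsForVPSparse
import Summits.ValiantsHypothesis.ValiantsHypothesis.Theorems.BarrierLeverDefinableEquationsSparsityWall
import Summits.ValiantsHypothesis.ValiantsHypothesis.Theorems.BarrierLeverNaturalProofsSeparateVNPSignSliceCRT
import HarnessLib

/-!
# Crux `BarrierLever.DefinableEquations` (stmt-8745) / `SingleSizeEquations` (stmt-8749) —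
# SPARSITY WALL AT THE OPEN RUNG `b = 2`: `SmallCircuits ℂ n 2` hits EVERY `poly(N)`-sparse
# distinguisher; every equation of size-`n²` circuits has `> N^a` monomials for every `a`
# (val-np-p5 g16)

`N = C(2n,n)` coefficient variables; `SmallCircuits ℂ n b = {f : deg f ≤ n, L(f) ≤ n^b}`.  The sparse
row of the cell's chart so far: `SmallCircuits ℂ n 4` hits all `N^a`-sparse polynomials for
`n ≥ 8a + 2` (`Sparse.isSuccinctHittingSet_sparse`, FSV 2018 Thm. 9 / Cor. 34 made succinct), the
coordinate/multilinear slices from `b = 3`, and at the OPEN rung `b = 2` only sparsity `< 2^{n-2}`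
(`rung_two_card_support_sharp`, val-np-p5 g12, who isolated the "sparse door at `b = 2`": a
`poly(N)`-sparse equation at `b = 2` would prove `SingleSizeEquations` there with `q = 0`).

**THEOREM (`isSuccinctHittingSet_sparse_two`).  For every `a` there is `n₀` such that for all
`n ≥ n₀` and all `b ≥ 2`, the coefficient vectors of `SmallCircuits ℂ n b` hit every nonzero
polynomial in the `N` coefficient variables with at most `N^a` monomials** (any degree, any circuit
size).  THE DOOR IS CLOSED: dually (`pow_lt_card_support_of_vanishes_two`) every equation for
`SmallCircuits ℂ n 2` — in particular every Boolean-sum witness `boolSum H` of the crux /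
`SingleSizeEquations` at `(n, 2)` (`pow_lt_card_support_boolSum_two`) and every FSV natural proof
against size `n^b`, `b ≥ 2`, of any constructivity (`pow_lt_card_support_of_isNaturalProof_two`) —
has MORE than `N^a` monomials, for every `a`, eventually in `n`; no `ΣΠ` circuit of polynomial size
is a natural proof against size-`n²` circuits (`no_sparse_naturalProof_two`).

PROOF.  FSV's shift (tree `Sparse.exists_narrow_monomial_shift`: the Taylor shift of an `s`-sparse
`D` to the full-support point `coeff((1 + Σ x_i)^n)` has a monomial with `≤ log₂ s ≤ 2an` variables)
plus the AMORTISED cost of the free monomials (`Batch.complexity_add_sparse_le_batch_std`, file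
`…SparsityWallTwoEngine`): with `k = a + 4` binary levels and blocks of `r = 16a(a+4) + 1`
variables, `(1 + Σ x_i)^n + Σ_{μ ∈ S} w_μ x^μ` with `|S| ≤ 2an` costs `≤ n²/4 + O_a(n) ≤ n²` gates
for `n ≥ n₀(a)` (`budget_two`) — the tree's files charged `n + 1` to `2n + 2` gates PER free monomial,
`≈ 2an² > n²`.  Size-parametrised forms for every budget `s` are given first (§1–§2).

WHAT THIS IS NOT.  No verdict on the crux: `b = 2` stays OPEN (Chatterjee–Tengse arXiv:2309.07612
§1.3 dir. 2) — a Boolean sum of size `N^a` may have `2^{N^a}` monomials; the wall excludes SPARSE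
witnesses only (the `ΣΠ` distinguisher row of the chart moves from `b = 4 / 3` to the open rung
`b = 2`, where every classical rank-method row already sits, val-np-p5 g10–g15).  Nothing on
`VP ≠ VNP`.  No named facts; definitions = the two explicit constants `levels`, `blockSize` and the
budget function `batchBudget`; standard axioms.  Refs: [ForbesShpilkaVolk2018] Def. 1/3, Thm. 9,
Lemma 31–32, Cor. 34; Bürgisser 2000 §2.1 / Rem. 2.7; Pippenger 1980 (amortised monomials).
-/

-- `Summit.ValiantsHypothesis.ValiantsHypothesis.…` repeats a component by the D-0017 layout
-- (single-conjunct summit), which the `dupNamespace` linter flags; the name is mandated.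
set_option linter.dupNamespace false

noncomputable section

namespace Summit.ValiantsHypothesis.ValiantsHypothesis.Theorems.BarrierLeverDefinableEquations

open MvPolynomial
open Literature.Computability.AlgebraicComplexity Literature.Barriers.ValiantsHypothesis
open Summit.ValiantsHypothesis.ValiantsHypothesis.Theorems.BarrierLever.SuccinctHittingSetsForVP
open scoped BigOperators

namespace SparsityWall

/-! ## §1 Size-parametrised forms: the batch budget -/

/-- The batch budget for `t` free monomials of degree `≤ n` in `n` variables with `k` levels and
blocks of `r` variables: `(n/r + 1)·2^r·r + t·(n/2^k + k(n/r + 3) + 2) + 1` gates on top of `L(f₀)`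
(`Batch.complexity_add_sparse_le_batch_std`). [cite: Burgisser2000, Rem. 2.7] -/
def batchBudget (n r k t : ℕ) : ℕ :=
  (n / r + 1) * 2 ^ r * r + t * (n / 2 ^ k + k * (n / r + 3) + 2) + 1

/-- The batch budget is monotone in the number of free monomials. [folklore] -/
theorem batchBudget_mono {n r k t t' : ℕ} (h : t ≤ t') : batchBudget n r k t ≤ batchBudget n r k t' := by
  unfold batchBudget; gcongr

/-- **Shifts along a small circuit stay small, amortised.**  If `deg f₀ ≤ n`, `L(f₀) ≤ s₀` and
`S` is a finite set of coefficient coordinates, then `f₀ + Σ_{μ ∈ S} w_μ x^μ` has degree `≤ n` and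
size `≤ s₀ + batchBudget n r k |S|` (`r ≥ 1`, any `k`). [cite: Burgisser2000, Rem. 2.7] -/
theorem shift_mem_of_batch {n r k s₀ : ℕ} (hr : 0 < r) {f₀ : MvPolynomial (Fin n) ℂ}
    (hf₀ : f₀.totalDegree ≤ n) (hL₀ : complexity f₀ ≤ s₀) (S : Finset (degLEMonomials n))
    (w : degLEMonomials n → ℂ) :
    (f₀ + ∑ μ ∈ S, monomial (μ : Fin n →₀ ℕ) (w μ)).totalDegree ≤ n ∧
      complexity (f₀ + ∑ μ ∈ S, monomial (μ : Fin n →₀ ℕ) (w μ)) ≤ s₀ + batchBudget n r k S.card := by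
  refine ⟨(totalDegree_add _ _).trans (max_le hf₀ (LowDegree.totalDegree_sparse_le S w)), ?_⟩
  have h := Batch.complexity_add_sparse_le_batch_std (n := n) hr k n f₀
    (fun μ : degLEMonomials n => (μ : Fin n →₀ ℕ)) S w (fun μ _ => μ.2)
  unfold batchBudget
  calc complexity (f₀ + ∑ μ ∈ S, monomial (μ : Fin n →₀ ℕ) (w μ))
      ≤ complexity f₀ + (n / r + 1) * 2 ^ r * r + S.card * (n / 2 ^ k + k * (n / r + 3) + 2) + 1 := h
    _ ≤ s₀ + (n / r + 1) * 2 ^ r * r + S.card * (n / 2 ^ k + k * (n / r + 3) + 2) + 1 := by gcongr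
    _ = _ := by ring

/-- **Taylor shifts of an equation along small circuits are wide, amortised.**  If `D` vanishes at
`coeff g` for every `g` of degree `≤ n` and size `≤ s`, `deg f₀ ≤ n`, `L(f₀) ≤ s₀` and
`s₀ + batchBudget n r k t ≤ s`, then every monomial of the shifted polynomial `D(coeff f₀ + w)` has
more than `t` variables. [cite: ForbesShpilkaVolk2018, Lemma 31] -/
theorem card_support_gt_of_shift_batch {n r k t s s₀ : ℕ} (hr : 0 < r)
    (h : s₀ + batchBudget n r k t ≤ s) {D : MvPolynomial (degLEMonomials n) ℂ}
    (hvan : ∀ g : MvPolynomial (Fin n) ℂ, g.totalDegree ≤ n → complexity g ≤ s →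
      eval (coeffVector (degLEMonomials n) g) D = 0)
    {f₀ : MvPolynomial (Fin n) ℂ} (hf₀ : f₀.totalDegree ≤ n) (hL₀ : complexity f₀ ≤ s₀)
    {m₀ : (degLEMonomials n) →₀ ℕ}
    (hm₀ : m₀ ∈ (aeval (fun m : degLEMonomials n => C (coeff (m : Fin n →₀ ℕ) f₀) + X m) D).support) :
    t < m₀.support.card := by
  classical
  by_contra hle
  push Not at hle
  obtain ⟨w, hw, hne⟩ := LowSupport.exists_eval_ne_zero_supported hm₀
  rw [ShiftedSupport.eval_shift] at hne
  obtain ⟨hdeg, hsize⟩ := shift_mem_of_batch (k := k) hr hf₀ hL₀ m₀.support w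
  have hs : complexity (f₀ + ∑ μ ∈ m₀.support, monomial (μ : Fin n →₀ ℕ) (w μ)) ≤ s :=
    hsize.trans ((Nat.add_le_add_left (batchBudget_mono hle) _).trans h)
  have := hvan _ hdeg hs
  rw [ShiftedSupport.coeffVector_shift f₀ m₀.support hw] at this
  exact hne this

/-- **Sparse distinguishers are hit, size-parametrised and amortised.**  If `f₀` has degree `≤ n`,
size `≤ s₀` and ALL its coefficients on `degLEMonomials n` nonzero, and `s₀ + batchBudget n r k t ≤ s`
(`r ≥ 1`), then the coefficient vectors of the degree-`≤ n`, size-`≤ s` polynomials hit every nonzero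
polynomial in the coefficient variables with fewer than `2^(t+1)` monomials.
[cite: ForbesShpilkaVolk2018, Lemma 32 and Cor. 34] -/
theorem isSuccinctHittingSet_sparse_of_batch {n r k t s s₀ : ℕ} (hr : 0 < r)
    (h : s₀ + batchBudget n r k t ≤ s) {f₀ : MvPolynomial (Fin n) ℂ} (hf₀ : f₀.totalDegree ≤ n)
    (hL₀ : complexity f₀ ≤ s₀) (hfull : ∀ m : degLEMonomials n, coeff (m : Fin n →₀ ℕ) f₀ ≠ 0) :
    IsSuccinctHittingSet (degLEMonomials n)
      {f : MvPolynomial (Fin n) ℂ | f.totalDegree ≤ n ∧ complexity f ≤ s}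
      {D : MvPolynomial (degLEMonomials n) ℂ | D.support.card < 2 ^ (t + 1)} := by
  intro D hD hD0
  by_contra hcon
  push Not at hcon
  obtain ⟨m, hm, hmcard⟩ := Sparse.exists_narrow_monomial_shift hfull hD0
  have hlt : t < m.support.card :=
    card_support_gt_of_shift_batch hr h (fun g hg hL => hcon g ⟨hg, hL⟩) hf₀ hL₀ hm
  have hlt' : 2 ^ m.support.card < 2 ^ (t + 1) := lt_of_le_of_lt hmcard hD
  have := (Nat.pow_lt_pow_iff_right (by norm_num)).mp hlt'
  omega

/-! ## §2 The budget at the open rung: constants `k = a + 4`, `r = 16a(a+4) + 1` -/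

/-- Number of binary levels used at sparsity exponent `a`: `k = a + 4` (so `2^k ≥ 16a`). [folklore] -/
def levels (a : ℕ) : ℕ := a + 4

/-- Block size used at sparsity exponent `a`: `r = 16a(a+4) + 1` (so `r ≥ 16ak`, `r ≥ 1`). [folklore] -/
def blockSize (a : ℕ) : ℕ := 16 * a * (a + 4) + 1

/-- `16a ≤ 2^(a+4)`. [folklore] -/
theorem sixteen_mul_le_two_pow_levels (a : ℕ) : 16 * a ≤ 2 ^ levels a := by
  unfold levels
  rw [pow_add]
  have : a ≤ 2 ^ a := (Nat.lt_two_pow_self).le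
  norm_num
  omega

/-- **The budget at `b = 2`.**  For `n ≥ n₀(a) := 4·(2^r + 2a(3k+2) + 3) + r·2^r` (with
`k = levels a`, `r = blockSize a`): `(2n + 1) + batchBudget n r k (2an) ≤ n²` — the full-support
circuit `(1 + Σ x_i)^n` plus `2an` amortised free monomials fit into size `n²`. [folklore] -/
theorem budget_two (a : ℕ) {n : ℕ}
    (hn : 4 * (2 ^ blockSize a + 2 * a * (3 * levels a + 2) + 3) + blockSize a * 2 ^ blockSize a ≤ n) :
    (2 * n + 1) + batchBudget n (blockSize a) (levels a) (2 * a * n) ≤ n ^ 2 := by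
  set k := levels a with hk
  set r := blockSize a with hr
  set Q := n / 2 ^ k with hQ
  set P := n / r with hP
  have hrpos : 0 < r := by rw [hr]; unfold blockSize; omega
  have hQn : 2 ^ k * Q ≤ n := by rw [hQ, mul_comm]; exact Nat.div_mul_le_self n (2 ^ k)
  have hPn : r * P ≤ n := by rw [hP, mul_comm]; exact Nat.div_mul_le_self n r
  have h16a : 16 * a ≤ 2 ^ k := sixteen_mul_le_two_pow_levels a
  have h16ak : 16 * a * k ≤ r := by rw [hr, hk]; unfold blockSize levels; omega
  -- the two quadratic terms are ≤ n²/8 each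
  have hQ' : 16 * a * Q ≤ n := (Nat.mul_le_mul_right Q h16a).trans hQn
  have hP' : 16 * a * k * P ≤ n := (Nat.mul_le_mul_right P h16ak).trans hPn
  have hQ'' : 16 * a * Q * n ≤ n * n := Nat.mul_le_mul_right n hQ'
  have hP'' : 16 * a * k * P * n ≤ n * n := Nat.mul_le_mul_right n hP'
  have hlin : (4 * (2 ^ r + 2 * a * (3 * k + 2) + 3) + r * 2 ^ r) * n ≤ n * n :=
    Nat.mul_le_mul_right n hn
  have hconst : r * 2 ^ r ≤ n := le_trans (Nat.le_add_left _ _) hn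
  have h12 : 12 ≤ n := by
    have h3 : 3 ≤ 2 ^ r + 2 * a * (3 * k + 2) + 3 := Nat.le_add_left 3 _
    have h4 : 12 ≤ 4 * (2 ^ r + 2 * a * (3 * k + 2) + 3) := by
      calc 12 = 4 * 3 := by norm_num
        _ ≤ 4 * (2 ^ r + 2 * a * (3 * k + 2) + 3) := Nat.mul_le_mul_left 4 h3
    exact le_trans h4 (le_trans (Nat.le_add_right _ _) hn)
  have hnn : 12 * n ≤ n * n := Nat.mul_le_mul_right n h12
  have hPr : P * 2 ^ r * r ≤ n * 2 ^ r := by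
    calc P * 2 ^ r * r = r * P * 2 ^ r := by ring
      _ ≤ n * 2 ^ r := Nat.mul_le_mul_right _ hPn
  unfold batchBudget
  rw [← hQ, ← hP]
  have expand : 2 * n + 1 + ((P + 1) * 2 ^ r * r + 2 * a * n * (Q + k * (P + 3) + 2) + 1) =
      2 * n + 2 + P * 2 ^ r * r + r * 2 ^ r + 2 * a * Q * n + 2 * a * k * P * n +
        6 * a * k * n + 4 * a * n := by ring
  have expand2 : (4 * (2 ^ r + 2 * a * (3 * k + 2) + 3) + r * 2 ^ r) * n =
      4 * (n * 2 ^ r) + 4 * (6 * a * k * n) + 4 * (4 * a * n) + 12 * n + r * 2 ^ r * n := by ring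
  rw [expand2] at hlin
  rw [expand, pow_two]
  have hA : 8 * (2 * a * Q * n) ≤ n * n := by
    calc 8 * (2 * a * Q * n) = 16 * a * Q * n := by ring
      _ ≤ n * n := hQ''
  have hB : 8 * (2 * a * k * P * n) ≤ n * n := by
    calc 8 * (2 * a * k * P * n) = 16 * a * k * P * n := by ring
      _ ≤ n * n := hP''
  omega

/-- The sparsity exponent in bits: `C(2n,n)^a < 2^(2an + 1)`. [folklore] -/
theorem choose_pow_lt_two_pow (a n : ℕ) : Nat.choose (2 * n) n ^ a < 2 ^ (2 * a * n + 1) :=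
  calc Nat.choose (2 * n) n ^ a ≤ (2 ^ (2 * n)) ^ a :=
        Nat.pow_le_pow_left (Nat.choose_le_two_pow (2 * n) n) a
    _ = 2 ^ (2 * a * n) := by rw [← pow_mul, Nat.mul_right_comm]
    _ < 2 ^ (2 * a * n + 1) := Nat.pow_lt_pow_right (by norm_num) (by omega)

/-! ## §3 The wall at `b = 2` -/

/-- **Size-`n²` circuits hit every `N^a`-sparse distinguisher (one `n`, explicit threshold).**  For
`n ≥ n₀(a)` (the threshold of `budget_two`), the degree-`≤ n` polynomials of size `≤ n²` hit every
nonzero polynomial in the `C(2n,n)` coefficient variables with at most `C(2n,n)^a` monomials.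
[cite: ForbesShpilkaVolk2018, Cor. 34] -/
theorem isSuccinctHittingSet_sparse_sq {a n : ℕ}
    (hn : 4 * (2 ^ blockSize a + 2 * a * (3 * levels a + 2) + 3) + blockSize a * 2 ^ blockSize a ≤ n) :
    IsSuccinctHittingSet (degLEMonomials n)
      {f : MvPolynomial (Fin n) ℂ | f.totalDegree ≤ n ∧ complexity f ≤ n ^ 2}
      {D : MvPolynomial (degLEMonomials n) ℂ | D.support.card ≤ Nat.choose (2 * n) n ^ a} := by
  have hr : 0 < blockSize a := by unfold blockSize; omega
  have hhit := isSuccinctHittingSet_sparse_of_batch (k := levels a) hr (budget_two a hn)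
    fullSupport_mem.1 fullSupport_mem.2
    (fun m => FullSupport.coeff_linearForm_pow_ne_zero (n := n) n (m : Fin n →₀ ℕ) m.2)
  refine hhit.mono le_rfl fun D hD => ?_
  exact lt_of_le_of_lt hD (choose_pow_lt_two_pow a n)

/-- **THE SPARSITY WALL AT THE OPEN RUNG.**  For every sparsity exponent `a` there is `n₀` such that
for all `n ≥ n₀` and every `b ≥ 2`, `SmallCircuits ℂ n b` (degree `≤ n`, size `≤ n^b`) is a succinct
hitting set for ALL nonzero polynomials in the `N = C(2n,n)` coefficient variables with at most `N^a`
monomials — FSV Thm. 9 / Cor. 34 (sparse case) at succinctness exponent `2` in the regime `d = n`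
(tree: exponent `4`, `Sparse.isSuccinctHittingSet_sparse`; at `b = 2` only sparsity `< 2^{n-2}`).
[cite: ForbesShpilkaVolk2018, Thm. 9 and Cor. 34] -/
theorem isSuccinctHittingSet_sparse_two :
    ∀ a : ℕ, ∃ n₀ : ℕ, ∀ n : ℕ, n₀ ≤ n → ∀ b : ℕ, 2 ≤ b →
      IsSuccinctHittingSet (degLEMonomials n) (SmallCircuits ℂ n b)
        {D : MvPolynomial (degLEMonomials n) ℂ | D.support.card ≤ Nat.choose (2 * n) n ^ a} := by
  intro a
  refine ⟨4 * (2 ^ blockSize a + 2 * a * (3 * levels a + 2) + 3) + blockSize a * 2 ^ blockSize a,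
    fun n hn b hb => ?_⟩
  have hn1 : 1 ≤ n := Nat.succ_le_of_lt (lt_of_lt_of_le (by positivity) hn)
  have h2 : IsSuccinctHittingSet (degLEMonomials n) (SmallCircuits ℂ n 2)
      {D : MvPolynomial (degLEMonomials n) ℂ | D.support.card ≤ Nat.choose (2 * n) n ^ a} :=
    isSuccinctHittingSet_sparse_sq hn
  exact h2.mono (smallCircuits_mono ℂ hb hn1) le_rfl

/-! ## §4 Duals: equations, natural proofs and crux witnesses at `b = 2` are super-polynomially dense -/

/-- **Every equation of size-`n^b` circuits, `b ≥ 2`, has more than `N^a` monomials** (for every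
`a`, eventually in `n`): a nonzero polynomial in the `C(2n,n)` coefficient variables vanishing at
`coeff f` for every `f ∈ SmallCircuits ℂ n b` is not `C(2n,n)^a`-sparse.
[cite: ForbesShpilkaVolk2018, Lemma 32 and Def. 1] -/
theorem pow_lt_card_support_of_vanishes_two :
    ∀ a : ℕ, ∃ n₀ : ℕ, ∀ n : ℕ, n₀ ≤ n → ∀ b : ℕ, 2 ≤ b →
      ∀ D : MvPolynomial (degLEMonomials n) ℂ, D ≠ 0 →
        (∀ f ∈ SmallCircuits ℂ n b, eval (coeffVector (degLEMonomials n) f) D = 0) →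
          Nat.choose (2 * n) n ^ a < D.support.card := by
  intro a
  obtain ⟨n₀, h⟩ := isSuccinctHittingSet_sparse_two a
  refine ⟨n₀, fun n hn b hb D hD0 hvan => ?_⟩
  by_contra hle
  push Not at hle
  obtain ⟨f, hf, hne⟩ := h n hn b hb D hle hD0
  exact hne (hvan f hf)

/-- **Natural proofs against size `n²` are super-polynomially dense.**  For every `a`, eventually in
`n`, for every `b ≥ 2`: an algebraically natural proof `D` against `SmallCircuits ℂ n b` in the sense
of FSV Def. 1 — for ANY distinguisher class `𝒟`, of any constructivity — has more than `C(2n,n)^a`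
monomials. [cite: ForbesShpilkaVolk2018, Def. 1 and Thm. 9] -/
theorem pow_lt_card_support_of_isNaturalProof_two :
    ∀ a : ℕ, ∃ n₀ : ℕ, ∀ n : ℕ, n₀ ≤ n → ∀ b : ℕ, 2 ≤ b →
      ∀ (𝒟 : Set (MvPolynomial (degLEMonomials n) ℂ)) (D : MvPolynomial (degLEMonomials n) ℂ),
        IsNaturalProof (degLEMonomials n) (SmallCircuits ℂ n b) 𝒟 D →
          Nat.choose (2 * n) n ^ a < D.support.card := by
  intro a
  obtain ⟨n₀, h⟩ := pow_lt_card_support_of_vanishes_two a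
  exact ⟨n₀, fun n hn b hb 𝒟 D hD => h n hn b hb D hD.2.1 hD.2.2⟩

/-- **No `ΣΠ` natural proofs at the open rung.**  For every `a`, eventually in `n`, for every
`b ≥ 2`, there is NO natural proof against `SmallCircuits ℂ n b` from the distinguisher class of
`C(2n,n)^a`-sparse polynomials (`ΣΠ` circuits of size `poly(N)`, whatever their degree).
[cite: ForbesShpilkaVolk2018, Thm. 4 and Thm. 9] -/
theorem no_sparse_naturalProof_two :
    ∀ a : ℕ, ∃ n₀ : ℕ, ∀ n : ℕ, n₀ ≤ n → ∀ b : ℕ, 2 ≤ b →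
      ¬ ∃ D, IsNaturalProof (degLEMonomials n) (SmallCircuits ℂ n b)
        {D : MvPolynomial (degLEMonomials n) ℂ | D.support.card ≤ Nat.choose (2 * n) n ^ a} D := by
  intro a
  obtain ⟨n₀, h⟩ := isSuccinctHittingSet_sparse_two a
  refine ⟨n₀, fun n hn b hb => ?_⟩
  rw [exists_isNaturalProof_iff, not_not]
  exact h n hn b hb

/-- **Crux currency: Boolean-sum witnesses at `(n, 2)` are not sparse.**  For every `a`, eventually
in `n`: if `boolSum H ≠ 0` vanishes at `coeff f` for every `f ∈ SmallCircuits ℂ n 2` — the data of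
`DefinableEquations` / `SingleSizeEquations` at the open rung, for ANY `q` and ANY size and degree of
`H` — then `boolSum H` has more than `C(2n,n)^a` monomials.  So the open rung is not proved by any
`q = 0` `ΣΠ` datum (a `poly(N)`-term polynomial of any degree): the sparse door of val-np-p5 g12 is
closed. [cite: ForbesShpilkaVolk2018, Def. 1] -/
theorem pow_lt_card_support_boolSum_two :
    ∀ a : ℕ, ∃ n₀ : ℕ, ∀ n : ℕ, n₀ ≤ n → ∀ (q : ℕ)
      (H : MvPolynomial (↥(degLEMonomials n) ⊕ Fin q) ℂ), boolSum H ≠ 0 →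
        (∀ f ∈ SmallCircuits ℂ n 2, eval (coeffVector (degLEMonomials n) f) (boolSum H) = 0) →
          Nat.choose (2 * n) n ^ a < (boolSum H).support.card := by
  intro a
  obtain ⟨n₀, h⟩ := pow_lt_card_support_of_vanishes_two a
  exact ⟨n₀, fun n hn q H hne hvan => h n hn 2 le_rfl (boolSum H) hne hvan⟩

/-- **In bits**: for every `t`, eventually in `n`, every equation for `SmallCircuits ℂ n 2` has at
least `2^(t·n)` monomials (the tree had `2^(n-2)`). [cite: ForbesShpilkaVolk2018, Lemma 32] -/
theorem two_pow_mul_le_card_support_of_vanishes_two :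
    ∀ t : ℕ, ∃ n₀ : ℕ, ∀ n : ℕ, n₀ ≤ n →
      ∀ D : MvPolynomial (degLEMonomials n) ℂ, D ≠ 0 →
        (∀ f ∈ SmallCircuits ℂ n 2, eval (coeffVector (degLEMonomials n) f) D = 0) →
          2 ^ (t * n) ≤ D.support.card := by
  intro t
  obtain ⟨n₀, h⟩ := pow_lt_card_support_of_vanishes_two t
  refine ⟨n₀, fun n hn D hD0 hvan => ?_⟩
  have hlt := h n hn 2 le_rfl D hD0 hvan
  have h2n : 2 ^ n ≤ Nat.choose (2 * n) n := by
    rw [← Nat.centralBinom_eq_two_mul_choose]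
    exact BarrierLever.NaturalProofsSeparateVNP.CRT.two_pow_le_centralBinom n
  calc 2 ^ (t * n) = (2 ^ n) ^ t := by rw [← pow_mul, mul_comm]
    _ ≤ Nat.choose (2 * n) n ^ t := Nat.pow_le_pow_left h2n t
    _ ≤ D.support.card := hlt.le

end SparsityWall

end Summit.ValiantsHypothesis.ValiantsHypothesis.Theorems.BarrierLeverDefinableEquations

end
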